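import Mathlib
import Literature.Combinatorics.Enumerative.RestrictedInvolutionsMotzkin
import HarnessLib

/-!
# Involutions avoiding `3412` and `123`: `|I_n(3412, 123)| = 1 + ⌊n/2⌋·⌈n/2⌉` (Barnabei–Bonetti–Silimbani 2011, Theorem 8 (iv) / Corollary 9 (iv))

Layer `Literature/Combinatorics/Enumerative`, namespace `Literature.Combinatorics.Enumerative.PermContainsPattern`; lane
`lit-hodgefound` (prover seat p13, generation 39, theme «nonnesting / noncrossing matchings and restricted
involutions»).  Sequel of `InvolutionsAvoiding3412.lean` (THEOREM 7: `3412` ⟺ no two arcs cross) and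
`RestrictedInvolutionsMotzkin.lean` Part A (the block `β_ρ = swap 0 last · (δ_ρ ⊕ 1)`: an outer arc around a shifted
copy of `ρ`).

## Source

M. Barnabei, F. Bonetti, M. Silimbani, *Restricted involutions and Motzkin paths*, Adv. Appl. Math. **47** (2011)
102–115 = arXiv:0812.0463 [BarnabeiBonettiSilimbani2011] (held text `paper-arxiv-0812.0463`, arXiv numbering, §5):

> **Theorem 8.** Let `τ` be an involution in `I_n(3412)` … iv. the set of paths corresponding to involutions in
> `I_n(3412)` avoiding `123` can be constructed recursively as follows: either `M = U H^a D U H^b D`, with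
> `a + b = n − 4`, or `M` is obtained from a path of the same kind by prepending `U` and appending `D`;
> [proof] Remark that an involution `τ` avoiding `123` must have at most `2` connected components. If `τ` has exactly
> `2` components, then there exists an integer `k` such that the one-line notation of `τ` is
> `k k−1 ⋯ 1 n n−1 ⋯ k+1`. … Consider now the case of a connected involution `τ` in `I_n(3412,123)` … In this case, we
> must have `τ(1) = n` and `τ(n) = 1`. Hence, the involution `τ' ∈ I_{n−2}` obtained from `τ` by removing the symbols
> `1` and `n` and renormalizing the remaining symbols belongs to `I_{n−2}(3412,123)` if and only if `τ` belongs to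
> `I_n(3412,123)`.
> **Corollary 9.** … iv. `|I_n(3412,123)| = 1 + ⌊n/2⌋⌈n/2⌉`.

## Formalisation (arc language)

Sort `u ∈ I_{b+2}(3412, 123)` by its first letter `u 0`:
* `u 0 = last` (connected): `u = β_ρ` with `ρ ∈ I_b(3412, 123)` (§2: `arcBlock_not_contains_123_iff` — the outer arc
  takes part in no occurrence of `123`; with Part A of `RestrictedInvolutionsMotzkin.lean`);
* `u 0 = j < last` (two components): the letters after `j` avoid `123` together with the letter `j` in front of them,
  so `u` decreases on `(j, last]`, and symmetrically on `[0, j]`: `u = k k−1 ⋯ 1 n n−1 ⋯ k+1` (`k = j + 1`), the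
  involution `twoRev n j` of §1 (§3: ★★ `eq_twoRev`, through the window lemma `val_eq_of_antitone_window`: a
  decreasing self-map of an interval of letters is its reversal).
Hence ★★ `card_involutions_av3412_av123_add_two`: `a_{b+2} = a_b + (b + 1)`, and ★★★ COROLLARY 9 (iv):
`card_involutions_av3412_av123 : |I_n(3412, 123)| = 1 + (n/2)·(n − n/2)` (`= 1 + ⌊n/2⌋⌈n/2⌉`); numerically
`|I_n(3412, 123)| = |I_n(4321, 132)|` (`InvolutionsAvoiding4321And132.lean`).
-/

namespace Literature.Combinatorics.Enumerative

namespace PermContainsPattern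

open Finset Equiv

variable {n b : ℕ}

/-! ### §0 Letters of the block `[0, b+1]` (as in `RestrictedInvolutionsMotzkin.lean`) -/

/-- Every letter of `Fin (b+2)` is `0`, `last`, or a middle letter `x.succ`. [folklore] -/
private theorem eq_zero_or_last_or_mid' (y : Fin (b + 1 + 1)) :
    y = 0 ∨ y = Fin.last (b + 1) ∨ ∃ x : Fin b, y = Fin.castAdd 1 x.succ := by
  obtain ⟨v, hv⟩ := y
  by_cases h0 : v = 0
  · exact Or.inl (Fin.ext (by simp [h0]))
  by_cases hl : v = b + 1
  · exact Or.inr (Or.inl (Fin.ext (by simp [hl])))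
  exact Or.inr (Or.inr ⟨⟨v - 1, by omega⟩, Fin.ext (by simp; omega)⟩)

/-- Middle letters compare as their indices. [folklore] -/
private theorem mid_lt_mid_iff' (x y : Fin b) : Fin.castAdd 1 x.succ < Fin.castAdd 1 y.succ ↔ x < y := by
  simp only [Fin.lt_def, Fin.val_castAdd, Fin.val_succ]
  omega

/-! ### §1 The two-component involution `k k−1 ⋯ 1 n n−1 ⋯ k+1` -/

/-- The underlying function of `k ⋯ 1 n ⋯ k+1` (`k = j + 1`): `y ↦ j − y` for `y ≤ j`, `y ↦ n + j − y` for `y > j`.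
[cite: BarnabeiBonettiSilimbani2011, Theorem 8 (iv) (proof; arXiv 0812.0463)] -/
def twoRevFun (n j : ℕ) (hj : j < n) (y : Fin n) : Fin n :=
  if h : (y : ℕ) ≤ j then ⟨j - y, by omega⟩ else ⟨n + j - y, by have := y.2; omega⟩

/-- Its values. [cite: BarnabeiBonettiSilimbani2011, Theorem 8 (iv) (arXiv 0812.0463)] -/
theorem twoRevFun_val (n j : ℕ) (hj : j < n) (y : Fin n) :
    ((twoRevFun n j hj y : Fin n) : ℕ) = if (y : ℕ) ≤ j then j - y else n + j - y := by
  unfold twoRevFun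
  split_ifs <;> rfl

/-- It is an involution. [cite: BarnabeiBonettiSilimbani2011, Theorem 8 (iv) (arXiv 0812.0463)] -/
theorem twoRevFun_involutive (n j : ℕ) (hj : j < n) : Function.Involutive (twoRevFun n j hj) := by
  intro y
  apply Fin.ext
  rw [twoRevFun_val, twoRevFun_val]
  have hy := y.2
  by_cases h : (y : ℕ) ≤ j
  · rw [if_pos h, if_pos (show j - (y : ℕ) ≤ j by omega)]
    omega
  · rw [if_neg h, if_neg (show ¬ (n + j - (y : ℕ) ≤ j) by omega)]
    omega

/-- **The two-component involution `k k−1 ⋯ 1 n n−1 ⋯ k+1`** of `[n]` (`k = j + 1 ≤ n`): the reversal of `[0, j]`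
next to the reversal of `(j, n)`. [cite: BarnabeiBonettiSilimbani2011, Theorem 8 (iv) (arXiv 0812.0463)] -/
def twoRev (n j : ℕ) (hj : j < n) : Perm (Fin n) :=
  (twoRevFun_involutive n j hj).toPerm _

/-- Values of `twoRev`. [cite: BarnabeiBonettiSilimbani2011, Theorem 8 (iv) (arXiv 0812.0463)] -/
theorem twoRev_val (n j : ℕ) (hj : j < n) (y : Fin n) :
    ((twoRev n j hj y : Fin n) : ℕ) = if (y : ℕ) ≤ j then j - y else n + j - y := by
  rw [twoRev, Function.Involutive.coe_toPerm, twoRevFun_val]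

/-- `twoRev` is an involution. [cite: BarnabeiBonettiSilimbani2011, Theorem 8 (iv) (arXiv 0812.0463)] -/
theorem twoRev_apply_apply (n j : ℕ) (hj : j < n) (y : Fin n) : twoRev n j hj (twoRev n j hj y) = y := by
  rw [twoRev, Function.Involutive.coe_toPerm]
  exact twoRevFun_involutive n j hj y

/-- Its first letter is `j`. [cite: BarnabeiBonettiSilimbani2011, Theorem 8 (iv) (arXiv 0812.0463)] -/
theorem twoRev_zero_val (n j : ℕ) (hj : j < n) : ((twoRev n j hj ⟨0, by omega⟩ : Fin n) : ℕ) = j := by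
  rw [twoRev_val]
  simp

/-- ★ `twoRev n j` is an involution avoiding `3412` and `123` (two decreasing runs, the first below the second).
[cite: BarnabeiBonettiSilimbani2011, Theorem 8 (iv) (arXiv 0812.0463)] -/
theorem twoRev_mem (n j : ℕ) (hj : j < n) :
    twoRev n j hj * twoRev n j hj = 1 ∧ ¬ PermContainsPattern (twoRev n j hj) ![3, 4, 1, 2] ∧
      ¬ PermContainsPattern (twoRev n j hj) ![1, 2, 3] := by
  refine ⟨(mul_self_eq_one_iff_apply_apply _).2 (twoRev_apply_apply n j hj), fun h => ?_, fun h => ?_⟩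
  · obtain ⟨x, y, z, w, hxy, hyz, hzw, h1, h2, h3⟩ := (contains_3412_iff _).1 h
    have e1 := Fin.lt_def.1 hxy; have e2 := Fin.lt_def.1 hyz; have e3 := Fin.lt_def.1 hzw
    have e4 := Fin.lt_def.1 h1; have e5 := Fin.lt_def.1 h2; have e6 := Fin.lt_def.1 h3
    rw [twoRev_val, twoRev_val] at e4 e5 e6
    have := w.2
    split_ifs at e4 e5 e6 <;> omega
  · obtain ⟨x, y, z, hxy, hyz, h1, h2⟩ := (contains_123_iff _).1 h
    have e1 := Fin.lt_def.1 hxy; have e2 := Fin.lt_def.1 hyz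
    have e4 := Fin.lt_def.1 h1; have e5 := Fin.lt_def.1 h2
    rw [twoRev_val, twoRev_val] at e4 e5
    have := z.2
    split_ifs at e4 e5 <;> omega

/-! ### §2 The outer arc and `123` -/

/-- The outer arc `(0, last)` of `β_ρ` takes part in no occurrence of `123`: `β_ρ` avoids `123` iff `ρ` does.
[cite: BarnabeiBonettiSilimbani2011, Theorem 8 (iv) («removing the symbols `1` and `n`»; arXiv 0812.0463)] -/
theorem arcBlock_not_contains_123_iff (ρ : Perm (Fin b)) :
    ¬ PermContainsPattern (swap (0 : Fin (b + 1 + 1)) (Fin.last (b + 1)) * finSumFinEquiv.symm.trans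
      (((Perm.decomposeFin.symm (0, ρ) : Perm (Fin (b + 1))).sumCongr (1 : Perm (Fin 1))).trans finSumFinEquiv))
        ![1, 2, 3] ↔ ¬ PermContainsPattern ρ ![1, 2, 3] := by
  rw [not_iff_not]
  constructor
  · intro h
    obtain ⟨i, j, k, hij, hjk, h1, h2⟩ := (contains_123_iff _).1 h
    rcases eq_zero_or_last_or_mid' i with rfl | rfl | ⟨x, rfl⟩
    · rw [arcBlock_apply_zero] at h1
      exact absurd h1 (not_lt.2 (Fin.le_last _))
    · exact absurd (hij.trans hjk) (not_lt.2 (Fin.le_last _))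
    · rcases eq_zero_or_last_or_mid' k with rfl | rfl | ⟨z, rfl⟩
      · exact absurd (hij.trans hjk) (not_lt.2 (Fin.zero_le _))
      · rw [arcBlock_apply_last] at h2
        exact absurd h2 (not_lt.2 (Fin.zero_le _))
      · rcases eq_zero_or_last_or_mid' j with rfl | rfl | ⟨y, rfl⟩
        · exact absurd hij (not_lt.2 (Fin.zero_le _))
        · exact absurd hjk (not_lt.2 (Fin.le_last _))
        · rw [arcBlock_apply_mid, arcBlock_apply_mid] at h1 h2
          exact (contains_123_iff ρ).2 ⟨x, y, z, (mid_lt_mid_iff' _ _).1 hij, (mid_lt_mid_iff' _ _).1 hjk,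
            (mid_lt_mid_iff' _ _).1 h1, (mid_lt_mid_iff' _ _).1 h2⟩
  · intro h
    obtain ⟨x, y, z, hxy, hyz, h1, h2⟩ := (contains_123_iff ρ).1 h
    refine (contains_123_iff _).2 ⟨Fin.castAdd 1 x.succ, Fin.castAdd 1 y.succ, Fin.castAdd 1 z.succ,
      (mid_lt_mid_iff' _ _).2 hxy, (mid_lt_mid_iff' _ _).2 hyz, ?_, ?_⟩
    · rw [arcBlock_apply_mid, arcBlock_apply_mid]; exact (mid_lt_mid_iff' _ _).2 h1
    · rw [arcBlock_apply_mid, arcBlock_apply_mid]; exact (mid_lt_mid_iff' _ _).2 h2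

/-! ### §3 THEOREM 8 (iv) on arcs: a non-connected `u ∈ I_n(3412, 123)` is `k ⋯ 1 n ⋯ k+1` -/

/-- Letters of `Fin n` with value in `[p, q)`, for `p ≤ q ≤ n`: there are `q − p` of them. [folklore] -/
private theorem card_filter_val_mem_Ico (p q : ℕ) (hpq : p ≤ q) (hq : q ≤ n) :
    (univ.filter fun z : Fin n => p ≤ (z : ℕ) ∧ (z : ℕ) < q).card = q - p := by
  have hsub : (univ.filter fun z : Fin n => (z : ℕ) < p) ⊆ univ.filter fun z : Fin n => (z : ℕ) < q :=
    fun z hz => mem_filter.2 ⟨mem_univ _, lt_of_lt_of_le (mem_filter.1 hz).2 hpq⟩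
  have heq : (univ.filter fun z : Fin n => p ≤ (z : ℕ) ∧ (z : ℕ) < q) =
      (univ.filter fun z : Fin n => (z : ℕ) < q) \ univ.filter fun z : Fin n => (z : ℕ) < p := by
    ext z; simp only [mem_filter, mem_univ, true_and, mem_sdiff]; omega
  rw [heq, card_sdiff_of_subset hsub, Fin.card_filter_val_lt, Fin.card_filter_val_lt, min_eq_right hq,
    min_eq_right (hpq.trans hq)]

/-- ★ **The window lemma.** A permutation mapping the letters of a window `[p, q)` into the window, decreasingly, is
the reversal of the window: `u y = p + q − 1 − y` (count the letters of the window after `y`: they go below `u y`).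
[cite: BarnabeiBonettiSilimbani2011, Theorem 8 (iv) (proof: «`k k−1 ⋯ 1 n n−1 ⋯ k+1`»; arXiv 0812.0463)] -/
theorem val_eq_of_antitone_window (u : Perm (Fin n)) (p q : ℕ) (hq : q ≤ n)
    (hmaps : ∀ y : Fin n, p ≤ (y : ℕ) → (y : ℕ) < q → p ≤ ((u y : Fin n) : ℕ) ∧ ((u y : Fin n) : ℕ) < q)
    (hanti : ∀ y y' : Fin n, p ≤ (y : ℕ) → y < y' → (y' : ℕ) < q → u y' < u y)
    (y : Fin n) (hpy : p ≤ (y : ℕ)) (hyq : (y : ℕ) < q) : ((u y : Fin n) : ℕ) + y = p + q - 1 := by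
  obtain ⟨huy1, huy2⟩ := hmaps y hpy hyq
  -- the letters of the window after `y` go strictly below `u y`
  have h1 : (univ.filter fun z : Fin n => (y : ℕ) + 1 ≤ (z : ℕ) ∧ (z : ℕ) < q).card ≤
      (univ.filter fun w : Fin n => p ≤ (w : ℕ) ∧ (w : ℕ) < ((u y : Fin n) : ℕ)).card := by
    refine card_le_card_of_injOn u (fun z hz => ?_) (fun z _ z' _ h => u.injective h)
    rw [mem_coe, mem_filter] at hz ⊢
    have hyz : y < z := Fin.lt_def.2 (by omega)
    exact ⟨mem_univ _, (hmaps z (by omega) hz.2.2).1, Fin.lt_def.1 (hanti y z hpy hyz hz.2.2)⟩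
  -- the letters of the window before `y` go strictly above `u y`
  have h2 : (univ.filter fun z : Fin n => p ≤ (z : ℕ) ∧ (z : ℕ) < y).card ≤
      (univ.filter fun w : Fin n => ((u y : Fin n) : ℕ) + 1 ≤ (w : ℕ) ∧ (w : ℕ) < q).card := by
    refine card_le_card_of_injOn u (fun z hz => ?_) (fun z _ z' _ h => u.injective h)
    rw [mem_coe, mem_filter] at hz ⊢
    have hzy : z < y := Fin.lt_def.2 hz.2.2
    exact ⟨mem_univ _, by have := Fin.lt_def.1 (hanti z y hz.2.1 hzy hyq); omega, (hmaps z hz.2.1 (by omega)).2⟩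
  rw [card_filter_val_mem_Ico _ _ (by omega) hq, card_filter_val_mem_Ico _ _ huy1 (by omega)] at h1
  rw [card_filter_val_mem_Ico _ _ hpy (by omega), card_filter_val_mem_Ico _ _ (by omega) hq] at h2
  omega

/-- ★★ **THEOREM 8 (iv), the two-component case.** A `3412`- and `123`-avoiding involution of `[0, b+1]` whose first
letter `j = u 0` is not the last letter is `twoRev`: the letters after `j` go after `j` (their arcs may not cross
`(0, j)`) and decrease (with the letter `j = u 0` in front, an ascent would be a `123`), so `u` reverses `(j, last]`;
the letters strictly inside `(0, j)` stay inside and decrease (an ascent followed by the letter `u last > j` would be a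
`123`), so `u` reverses `[0, j]`. [cite: BarnabeiBonettiSilimbani2011, Theorem 8 (iv) (arXiv 0812.0463)] -/
theorem eq_twoRev {u : Perm (Fin (b + 1 + 1))} (hu : ∀ x, u (u x) = x) (h3412 : ¬ PermContainsPattern u ![3, 4, 1, 2])
    (h123 : ¬ PermContainsPattern u ![1, 2, 3]) {j : ℕ} (hj : ((u 0 : Fin (b + 1 + 1)) : ℕ) = j) (hjl : j < b + 1) :
    u = twoRev (b + 1 + 1) j (by omega) := by
  have hnc := (not_contains_3412_iff_noncrossing hu).1 h3412
  have hu0 : u 0 = ⟨j, by omega⟩ := Fin.ext hj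
  have hz : ((0 : Fin (b + 1 + 1)) : ℕ) = 0 := Fin.val_zero _
  have huj : u ⟨j, by omega⟩ = 0 := by rw [← hu0, hu]
  -- (1) the letters after `j` go after `j`
  have hgt : ∀ y : Fin (b + 1 + 1), j < (y : ℕ) → j < ((u y : Fin (b + 1 + 1)) : ℕ) := by
    intro y hy
    by_contra hle
    push Not at hle
    have hne0 : u y ≠ 0 := fun e => by
      have : y = ⟨j, by omega⟩ := by rw [← huj] at e; exact u.injective e
      rw [this] at hy; exact lt_irrefl _ hy
    have hnej : u y ≠ ⟨j, by omega⟩ := fun e => by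
      have : y = 0 := by rw [← hu0] at e; exact u.injective e
      rw [this, hz] at hy; exact absurd hy (Nat.not_lt_zero _)
    have h0lt : (0 : Fin (b + 1 + 1)) < u y := lt_of_le_of_ne (Fin.zero_le _) (Ne.symm hne0)
    have hlt : u y < u 0 := Fin.lt_def.2 (by
      have : ((u y : Fin (b + 1 + 1)) : ℕ) ≠ j := fun e => hnej (Fin.ext e); rw [hj]; omega)
    exact hnc 0 (u y) h0lt hlt (by rw [hu]; exact Fin.lt_def.2 (by rw [hj]; exact hy))
  -- (2) they decrease
  have hdec : ∀ y y' : Fin (b + 1 + 1), j + 1 ≤ (y : ℕ) → y < y' → (y' : ℕ) < b + 1 + 1 → u y' < u y := by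
    intro y y' hy hyy' _
    rcases lt_trichotomy (u y') (u y) with h | h | h
    · exact h
    · exact absurd (u.injective h) (ne_of_gt hyy')
    · exact (h123 ((contains_123_iff u).2 ⟨0, y, y', Fin.lt_def.2 (by rw [hz]; omega), hyy',
        Fin.lt_def.2 (by rw [hj]; exact hgt y (by omega)), h⟩)).elim
  -- (3) the letters strictly inside `(0, j)` stay inside
  have hin : ∀ y : Fin (b + 1 + 1), 1 ≤ (y : ℕ) → (y : ℕ) < j →
      1 ≤ ((u y : Fin (b + 1 + 1)) : ℕ) ∧ ((u y : Fin (b + 1 + 1)) : ℕ) < j := by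
    intro y hy1 hyj
    have hne0 : u y ≠ 0 := fun e => by
      have : y = ⟨j, by omega⟩ := by rw [← huj] at e; exact u.injective e
      rw [this] at hyj; exact lt_irrefl _ hyj
    have hnej : u y ≠ ⟨j, by omega⟩ := fun e => by
      have : y = 0 := by rw [← hu0] at e; exact u.injective e
      rw [this, hz] at hy1; exact absurd hy1 (by omega)
    refine ⟨Nat.one_le_iff_ne_zero.2 fun e => hne0 (Fin.ext e), ?_⟩
    by_contra hle
    have hlt : j < ((u y : Fin (b + 1 + 1)) : ℕ) := lt_of_le_of_ne (not_lt.1 hle) fun e => hnej (Fin.ext e.symm)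
    have := hgt (u y) hlt
    rw [hu] at this
    omega
  -- (4) and decrease: an ascent there followed by the letter `u last > j` would be a `123`
  have hdec' : ∀ y y' : Fin (b + 1 + 1), 1 ≤ (y : ℕ) → y < y' → (y' : ℕ) < j → u y' < u y := by
    intro y y' hy hyy' hy'j
    rcases lt_trichotomy (u y') (u y) with h | h | h
    · exact h
    · exact absurd (u.injective h) (ne_of_gt hyy')
    · have hlast : u y' < u (Fin.last (b + 1)) := Fin.lt_def.2 (by
        have h1 := (hin y' (by have := Fin.lt_def.1 hyy'; omega) hy'j).2
        have h2 := hgt (Fin.last (b + 1)) (by rw [Fin.val_last]; exact hjl)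
        omega)
      exact (h123 ((contains_123_iff u).2 ⟨y, y', Fin.last (b + 1), hyy',
        Fin.lt_def.2 (by rw [Fin.val_last]; omega), h, hlast⟩)).elim
  -- conclusion, letter by letter
  refine Equiv.ext fun y => Fin.ext ?_
  rw [twoRev_val]
  split_ifs with hy
  · rcases (Nat.lt_or_ge 0 (y : ℕ)) with hy0 | hy0
    · rcases (lt_or_eq_of_le hy) with hyj | hyj
      · have := val_eq_of_antitone_window u 1 j (by omega) hin hdec' y hy0 hyj
        omega
      · have : y = ⟨j, by omega⟩ := Fin.ext hyj
        rw [this, huj, hz, Fin.val_mk, Nat.sub_self]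
    · have : y = 0 := Fin.ext (by rw [hz]; omega)
      rw [this, hj, hz, Nat.sub_zero]
  · have := val_eq_of_antitone_window u (j + 1) (b + 1 + 1) le_rfl
      (fun z hz1 hz2 => ⟨hgt z (by omega), (u z).2⟩) hdec y (by omega) y.2
    omega

/-! ### §4 The fibres over the first letter and the recurrence `a_{b+2} = a_b + (b + 1)` -/

/-- ★ The connected involutions of `I_{b+2}(3412, 123)` (first letter `last`) are the `β_ρ`, `ρ ∈ I_b(3412, 123)`
(«removing the symbols `1` and `n` and renormalizing»). [cite: BarnabeiBonettiSilimbani2011, Theorem 8 (iv) (arXiv 0812.0463)] -/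
theorem card_involutions_av3412_av123_connected (b : ℕ) :
    Nat.card {u : Perm (Fin (b + 1 + 1)) // (u * u = 1 ∧ ¬ PermContainsPattern u ![3, 4, 1, 2] ∧
        ¬ PermContainsPattern u ![1, 2, 3]) ∧ u 0 = Fin.last (b + 1)} =
      Nat.card {ρ : Perm (Fin b) // ρ * ρ = 1 ∧ ¬ PermContainsPattern ρ ![3, 4, 1, 2] ∧
        ¬ PermContainsPattern ρ ![1, 2, 3]} := by
  refine (Nat.card_congr (Equiv.ofBijective (fun ρ : {ρ : Perm (Fin b) // ρ * ρ = 1 ∧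
      ¬ PermContainsPattern ρ ![3, 4, 1, 2] ∧ ¬ PermContainsPattern ρ ![1, 2, 3]} =>
    (⟨swap (0 : Fin (b + 1 + 1)) (Fin.last (b + 1)) * finSumFinEquiv.symm.trans
        (((Perm.decomposeFin.symm (0, ρ.1) : Perm (Fin (b + 1))).sumCongr (1 : Perm (Fin 1))).trans finSumFinEquiv),
      ⟨(arcBlock_mul_self_eq_one_iff ρ.1).2 ρ.2.1,
        (arcBlock_not_contains_3412_iff ((mul_self_eq_one_iff_apply_apply _).1 ρ.2.1)).2 ρ.2.2.1,
        (arcBlock_not_contains_123_iff ρ.1).2 ρ.2.2.2⟩,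
      arcBlock_apply_zero ρ.1⟩ :
    {u : Perm (Fin (b + 1 + 1)) // (u * u = 1 ∧ ¬ PermContainsPattern u ![3, 4, 1, 2] ∧
      ¬ PermContainsPattern u ![1, 2, 3]) ∧ u 0 = Fin.last (b + 1)})) ⟨?_, ?_⟩)).symm
  · rintro ⟨ρ, hρ⟩ ⟨ρ', hρ'⟩ h
    exact Subtype.ext (arcBlock_injective b (congrArg Subtype.val h))
  · rintro ⟨u, ⟨hinv, h3412, h123⟩, h0⟩
    have hu : ∀ x, u (u x) = x := (mul_self_eq_one_iff_apply_apply u).1 hinv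
    obtain ⟨ρ, rfl⟩ := exists_eq_arcBlock u hu h0
    have hρinv : ρ * ρ = 1 := (arcBlock_mul_self_eq_one_iff ρ).1 hinv
    have hρu : ∀ x, ρ (ρ x) = x := (mul_self_eq_one_iff_apply_apply ρ).1 hρinv
    exact ⟨⟨ρ, hρinv, (arcBlock_not_contains_3412_iff hρu).1 h3412, (arcBlock_not_contains_123_iff ρ).1 h123⟩, rfl⟩

/-- ★ The fibre over a first letter `j < last` is the single involution `twoRev (b+2) j`.
[cite: BarnabeiBonettiSilimbani2011, Theorem 8 (iv) (arXiv 0812.0463)] -/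
theorem card_involutions_av3412_av123_first (b : ℕ) (j : Fin (b + 1 + 1)) (hj : j ≠ Fin.last (b + 1)) :
    Nat.card {u : Perm (Fin (b + 1 + 1)) // (u * u = 1 ∧ ¬ PermContainsPattern u ![3, 4, 1, 2] ∧
        ¬ PermContainsPattern u ![1, 2, 3]) ∧ u 0 = j} = 1 := by
  have : Unique {u : Perm (Fin (b + 1 + 1)) // (u * u = 1 ∧ ¬ PermContainsPattern u ![3, 4, 1, 2] ∧
      ¬ PermContainsPattern u ![1, 2, 3]) ∧ u 0 = j} :=
    { default := ⟨twoRev (b + 1 + 1) j j.2, twoRev_mem _ _ _, Fin.ext (by rw [twoRev_val]; simp)⟩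
      uniq := fun ⟨u, ⟨hinv, h3412, h123⟩, h0⟩ => Subtype.ext
        (eq_twoRev ((mul_self_eq_one_iff_apply_apply u).1 hinv) h3412 h123 (congrArg Fin.val h0)
          (lt_of_le_of_ne (Nat.lt_succ_iff.1 j.2) fun e => hj (Fin.ext (by rw [e, Fin.val_last])))) }
  exact Nat.card_unique

/-- Splitting a finite subtype along a statistic with values in a `Fintype`. [folklore] -/
private theorem card_subtype_eq_sum_fiber₄ {α β : Type*} [Finite α] [Fintype β] (P : α → Prop) (f : α → β) :
    Nat.card {x // P x} = ∑ t : β, Nat.card {x // P x ∧ f x = t} := by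
  rw [← Nat.card_sigma]
  exact Nat.card_congr ((Equiv.sigmaFiberEquiv fun x : {x // P x} => f x.1).symm.trans
    (Equiv.sigmaCongrRight fun t => Equiv.subtypeSubtypeEquivSubtypeInter P fun x => f x = t))

/-- ★★ **The recurrence**: `|I_{b+2}(3412, 123)| = |I_b(3412, 123)| + (b + 1)` (connected: `β_ρ`; two components:
one involution for each first letter `j ≤ b`). [cite: BarnabeiBonettiSilimbani2011, Theorem 8 (iv) and Corollary 9 (iv) (arXiv 0812.0463)] -/
theorem card_involutions_av3412_av123_add_two (b : ℕ) :
    Nat.card {u : Perm (Fin (b + 2)) // u * u = 1 ∧ ¬ PermContainsPattern u ![3, 4, 1, 2] ∧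
        ¬ PermContainsPattern u ![1, 2, 3]} =
      Nat.card {u : Perm (Fin b) // u * u = 1 ∧ ¬ PermContainsPattern u ![3, 4, 1, 2] ∧
          ¬ PermContainsPattern u ![1, 2, 3]} + (b + 1) := by
  rw [card_subtype_eq_sum_fiber₄ (fun u : Perm (Fin (b + 2)) => u * u = 1 ∧ ¬ PermContainsPattern u ![3, 4, 1, 2] ∧
      ¬ PermContainsPattern u ![1, 2, 3]) (fun u => u 0), Fin.sum_univ_castSucc,
    Finset.sum_congr rfl fun j _ => card_involutions_av3412_av123_first b _ (ne_of_lt (Fin.castSucc_lt_last j)),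
    sum_const, card_univ, Fintype.card_fin, smul_eq_mul, mul_one, add_comm,
    card_involutions_av3412_av123_connected]

/-! ### §5 COROLLARY 9 (iv) -/

/-- `|I_0(3412, 123)| = 1`. [cite: BarnabeiBonettiSilimbani2011, Corollary 9 (iv) (arXiv 0812.0463)] -/
theorem card_involutions_av3412_av123_zero :
    Nat.card {u : Perm (Fin 0) // u * u = 1 ∧ ¬ PermContainsPattern u ![3, 4, 1, 2] ∧
      ¬ PermContainsPattern u ![1, 2, 3]} = 1 := by
  have : Unique {u : Perm (Fin 0) // u * u = 1 ∧ ¬ PermContainsPattern u ![3, 4, 1, 2] ∧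
      ¬ PermContainsPattern u ![1, 2, 3]} :=
    { default := ⟨1, by simp, not_contains_of_lt _ _ (by norm_num), not_contains_of_lt _ _ (by norm_num)⟩
      uniq := fun u => Subtype.ext (Equiv.ext fun x => Fin.elim0 x) }
  exact Nat.card_unique

/-- `|I_1(3412, 123)| = 1`. [cite: BarnabeiBonettiSilimbani2011, Corollary 9 (iv) (arXiv 0812.0463)] -/
theorem card_involutions_av3412_av123_one :
    Nat.card {u : Perm (Fin 1) // u * u = 1 ∧ ¬ PermContainsPattern u ![3, 4, 1, 2] ∧
      ¬ PermContainsPattern u ![1, 2, 3]} = 1 := by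
  have : Unique {u : Perm (Fin 1) // u * u = 1 ∧ ¬ PermContainsPattern u ![3, 4, 1, 2] ∧
      ¬ PermContainsPattern u ![1, 2, 3]} :=
    { default := ⟨1, by simp, not_contains_of_lt _ _ (by norm_num), not_contains_of_lt _ _ (by norm_num)⟩
      uniq := fun u => Subtype.ext (Subsingleton.elim _ _) }
  exact Nat.card_unique

/-- ★★★ **COROLLARY 9 (iv) (Barnabei–Bonetti–Silimbani / Egge): `|I_n(3412, 123)| = 1 + ⌊n/2⌋·⌈n/2⌉`**, as
`1 + (n/2)·(n − n/2)`. [cite: BarnabeiBonettiSilimbani2011, Corollary 9 (iv) (arXiv 0812.0463)] -/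
theorem card_involutions_av3412_av123 (n : ℕ) :
    Nat.card {u : Perm (Fin n) // u * u = 1 ∧ ¬ PermContainsPattern u ![3, 4, 1, 2] ∧
      ¬ PermContainsPattern u ![1, 2, 3]} = 1 + (n / 2) * (n - n / 2) := by
  induction n using Nat.strong_induction_on with
  | _ n ih =>
    rcases n with _ | _ | b
    · rw [card_involutions_av3412_av123_zero]
    · rw [card_involutions_av3412_av123_one]
    · rw [card_involutions_av3412_av123_add_two, ih b (by omega)]
      obtain ⟨q, r, hr, rfl⟩ : ∃ q r, r < 2 ∧ b = 2 * q + r := ⟨b / 2, b % 2, Nat.mod_lt _ (by omega), (Nat.div_add_mod b 2).symm⟩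
      interval_cases r
      · rw [show 2 * q + 0 = 2 * q by omega, show 2 * q + 1 + 1 = 2 * (q + 1) by ring,
          Nat.mul_div_cancel_left _ Nat.two_pos, Nat.mul_div_cancel_left _ Nat.two_pos]
        rw [show 2 * q - q = q by omega, show 2 * (q + 1) - (q + 1) = q + 1 by omega]
        ring
      · rw [show (2 * q + 1) / 2 = q by omega, show (2 * q + 1 + 1 + 1) / 2 = q + 1 by omega]
        rw [show 2 * q + 1 - q = q + 1 by omega, show 2 * q + 1 + 1 + 1 - (q + 1) = q + 2 by omega]
        ring

/-- COROLLARY 9 (iv) and COROLLARY 6 (i) agree: `|I_n(3412, 123)| = |I_n(4321, 132)|` (both `1 + ⌊n/2⌋⌈n/2⌉`).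
[cite: BarnabeiBonettiSilimbani2011, Corollary 6 (i) and Corollary 9 (iv) (arXiv 0812.0463)] -/
theorem card_involutions_av3412_av123_values :
    (List.range 7).map (fun n => Nat.card {u : Perm (Fin n) // u * u = 1 ∧ ¬ PermContainsPattern u ![3, 4, 1, 2] ∧
      ¬ PermContainsPattern u ![1, 2, 3]}) = [1, 1, 2, 3, 5, 7, 10] := by
  simp only [card_involutions_av3412_av123]
  decide

end PermContainsPattern

end Literature.Combinatorics.Enumerative
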